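import Summits.AtomisticToContinuum.HydrodynamicLimit.Theorems.LambertianContactSwapLambertianEulerCollisionalInputs
import Summits.AtomisticToContinuum.HydrodynamicLimit.Theorems.LambertianContactSwapLambertianEulerRestartInLaw
import Summits.AtomisticToContinuum.HydrodynamicLimit.Theorems.LambertianContactSwapLambertianEulerWindowCocycle
import Summits.AtomisticToContinuum.HydrodynamicLimit.Theorems.LambertianContactSwapLambertianEulerJumpSumTools
import Summits.AtomisticToContinuum.HydrodynamicLimit.Theorems.LambertianContactSwapLambertianEulerKineticWindowTools
import HarnessLib

/-!
# The entropy step with restart for the clamped COLLISIONAL window functional of the Lambertian gas (line `Sketch`, crux stmt-11854)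

Support file (`--supports stmt-AtomisticToContinuum-11854`).  Step (ENT-J) of lead c8's dissection of the collisional log-heart
(`…HeartsLog.CollisionalOneBlockInMeanLambdaLog` ⇐ CCW-Λ + CAT-Λ + TL1G-Λ, `…CollisionalInputs`): the clamped collisional window
functional of ONE trajectory over a macroscopic window `(a, a+h]` — a truncated sum over the contacts `m < K_{a+h}`, `a < t_{m+1}` of
truncated jumps `trunc_ℓ J(t_{m+1}, z_m)` (for a jump observable `J` that sees a post-collisional state only through its exit
configuration), minus the window time integral `∫_a^{a+h} Σ_i GX(r, (Λ_r)_i) dr` of a bounded one-body observable, minus a constant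
(the statics `dLZ`) — IS, for `P ⊗ γ^ℕ`-a.e. (datum, noise), the same functional of the RESTARTED pair `(Λ_a, ξs(· + K_a))` over `(0, h]`
(`clampedFunctional_ae_eq_restart`: the pathwise cocycles `jumpSum_window_eq_restart` / `intervalIntegral_window_eq_restart` of
`…WindowCocycle` off the null accumulation set); the restarted functional is measurable and bounded (`measurable_restartedFunctional`,
`abs_restartedFunctional_le`); hence, by the fresh-tail identity in law and the entropy inequality across the noise factor
(`…RestartInLaw.restart_entropyInequality`) at rate `β = γ/h`:
`−E_{P⊗γ^ℕ}[clamped collisional functional over (a,a+h]] ≤ (h/γ)(M + Γ)` whenever the entropy of the law of `Λ_a` w.r.t. the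
reference `R` is `≤ M` and the log-moment-generating function of `−(γ/h)·(restarted functional)` under `R ⊗ γ^ℕ` is `≤ Γ`
(`neg_clampedFunctional_le_of_ent`) — the collisional twin of `…KineticWindowTools.neg_window_le_of_ent`.  With `J` the compensated jump
of the reference exponent, `GX = XcolClamp V` and the constant `dLZ(a, a+h)` the restarted functional is `…CollisionalInputs.Wcol` a.e., and
`Γ = γ(ϑ + A′e^{−a′V²})(N+1)` is what CCW-Λ supplies.

Lead prover-line-stmt-AtomisticToContinuum-11854-c8-0, 2026-08-17.  [cite: Yau1991, §2] [cite: KipnisLandim1999, Appendix 1 §8]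
-/

noncomputable section

namespace Summit.AtomisticToContinuum.HydrodynamicLimit.Theorems.LambertianContactSwapLambertianEulerCollisionalWindowRestart

open scoped BigOperators Topology ENNReal
open MeasureTheory ProbabilityTheory Filter Set InformationTheory
open Literature.MathematicalPhysics.KineticTheory
open Literature.Analysis.FluidPDE Literature.Analysis.FluidPDE.Alexander
open Summit.AtomisticToContinuum.HydrodynamicLimit.Theorems
open Summit.AtomisticToContinuum.HydrodynamicLimit.Theorems.LambertianContactSwapLambertianEulerCollisionalInputs
open Summit.AtomisticToContinuum.HydrodynamicLimit.Theorems.LambertianContactSwapLambertianEulerRestartInLaw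
open Summit.AtomisticToContinuum.HydrodynamicLimit.Theorems.LambertianContactSwapLambertianEulerWindowCocycle
open Summit.AtomisticToContinuum.HydrodynamicLimit.Theorems.LambertianContactSwapLambertianEulerJumpSumTools

variable {σ : ℝ} {N : ℕ}

/-! ## §1 The clamped collisional functional of a window is the restarted one, almost surely -/

/-- **RESTART OF THE CLAMPED COLLISIONAL WINDOW FUNCTIONAL (pathwise, a.e.).** For an initial law `P ≪ liouville` (so that the
collision instants do not accumulate, `P ⊗ γ^ℕ`-a.e.), a jump observable `J` that sees a post-collisional state only through its
exit configuration (invariance under the initial free flight), any one-body observable `GX`, levels `ℓ, L` and a constant `cZ`: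
the clamped collisional functional of the window `(a, a+h]` of the trajectory from time `0` equals the same functional over `(0, h]`
of the pair `(Λ_a, ξs(· + K_a))`, `P ⊗ γ^ℕ`-almost surely. [folklore] -/
theorem clampedFunctional_ae_eq_restart (hσ : 0 < σ) (hσ' : σ < 2⁻¹) (N : ℕ) (P : Measure (Config (N + 1) (Fin 3) T3))
    (hP : P ≪ liouville (Torus.geometry (Fin 3)) (N + 1) (hsDiameter σ N))
    (J : ℝ × Config (N + 1) (Fin 3) T3 → ℝ)
    (hJinv : ∀ (t : ℝ) (w : Config (N + 1) (Fin 3) T3) (u : ℝ), 0 ≤ u →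
      ENNReal.ofReal u < freeExitTime (Torus.geometry (Fin 3)) (hsDiameter σ N) w →
      freeExitTime (Torus.geometry (Fin 3)) (hsDiameter σ N) w ≠ ⊤ →
      J (t, freeFlight (Torus.geometry (Fin 3)) u w) = J (t, w))
    (GX : ℝ × (T3 × V3) → ℝ) (ℓ L cZ : ℝ) {a h : ℝ} (ha : 0 ≤ a) (hh : 0 ≤ h) :
    ∀ᵐ p ∂(P.prod (lambertNoise (Fin 3))),
      trunc L (∑ m ∈ Finset.range (lambertCount (Torus.geometry (Fin 3)) (hsDiameter σ N) p.2 p.1 (a + h)),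
          if a < (lambertInstant (Torus.geometry (Fin 3)) (hsDiameter σ N) p.2 p.1 (m + 1)).toReal then
            trunc ℓ (J ((lambertInstant (Torus.geometry (Fin 3)) (hsDiameter σ N) p.2 p.1 (m + 1)).toReal,
              lambertStateAfter (Torus.geometry (Fin 3)) (hsDiameter σ N) p.2 p.1 m)) else 0) -
        (∫ r in a..(a + h), ∑ i, GX (r, lambertFlow (Torus.geometry (Fin 3)) (hsDiameter σ N) p.2 p.1 r i)) - cZ =
      (fun q : Config (N + 1) (Fin 3) T3 × (ℕ → V3) =>
        trunc L (∑ m ∈ Finset.range (lambertCount (Torus.geometry (Fin 3)) (hsDiameter σ N) q.2 q.1 h),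
            if 0 < (lambertInstant (Torus.geometry (Fin 3)) (hsDiameter σ N) q.2 q.1 (m + 1)).toReal then
              trunc ℓ (J (a + (lambertInstant (Torus.geometry (Fin 3)) (hsDiameter σ N) q.2 q.1 (m + 1)).toReal,
                lambertStateAfter (Torus.geometry (Fin 3)) (hsDiameter σ N) q.2 q.1 m)) else 0) -
          (∫ r in (0 : ℝ)..h, ∑ i, GX (a + r, lambertFlow (Torus.geometry (Fin 3)) (hsDiameter σ N) q.2 q.1 r i)) - cZ)
        (lambertFlow (Torus.geometry (Fin 3)) (hsDiameter σ N) p.2 p.1 a,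
          fun n => p.2 (n + lambertCount (Torus.geometry (Fin 3)) (hsDiameter σ N) p.2 p.1 a)) := by
  filter_upwards [ae_nonAccumulation_of_absolutelyContinuous hσ hσ' N P hP] with p hp
  have hA := hp a
  have hAH := hp (a + h)
  have hjump := jumpSum_window_eq_restart (G := Torus.geometry (Fin 3)) (ε := hsDiameter σ N)
    (fun t w => trunc ℓ (J (t, w))) (fun t w u hu hlt hne => by simp only [hJinv t w u hu hlt hne]) ha hh hA hAH
  have hint := intervalIntegral_window_eq_restart (G := Torus.geometry (Fin 3)) (ε := hsDiameter σ N)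
    (fun r w => ∑ i, GX (r, w i)) (ξs := p.2) (z := p.1) ha hh hAH
  rw [hjump, hint]

/-! ## §2 The restarted functional: measurability and the uniform bound -/

/-- **Measurability of the restarted clamped collisional functional** (jump part by `measurable_jumpSum` on the time-shifted truncated
observable; time-integral part by joint measurability of `Λ` and `integral_prod_right'`). [folklore] -/
theorem measurable_restartedFunctional (hσ : 0 < σ) (hσ' : σ < 2⁻¹) (N : ℕ)
    {J : ℝ × Config (N + 1) (Fin 3) T3 → ℝ} (hJ : Measurable J) {GX : ℝ × (T3 × V3) → ℝ} (hGX : Measurable GX)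
    (ℓ L cZ a : ℝ) {h : ℝ} (hh : 0 ≤ h) :
    Measurable fun q : Config (N + 1) (Fin 3) T3 × (ℕ → V3) =>
      trunc L (∑ m ∈ Finset.range (lambertCount (Torus.geometry (Fin 3)) (hsDiameter σ N) q.2 q.1 h),
          if 0 < (lambertInstant (Torus.geometry (Fin 3)) (hsDiameter σ N) q.2 q.1 (m + 1)).toReal then
            trunc ℓ (J (a + (lambertInstant (Torus.geometry (Fin 3)) (hsDiameter σ N) q.2 q.1 (m + 1)).toReal,
              lambertStateAfter (Torus.geometry (Fin 3)) (hsDiameter σ N) q.2 q.1 m)) else 0) -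
        (∫ r in (0 : ℝ)..h, ∑ i, GX (a + r, lambertFlow (Torus.geometry (Fin 3)) (hsDiameter σ N) q.2 q.1 r i)) - cZ := by
  have htr : ∀ c : ℝ, Measurable (trunc c) := fun c =>
    (measurable_const.max (measurable_const.min measurable_id))
  -- the jump part: the time-shifted truncated observable is measurable
  have hJa : Measurable fun q : ℝ × Config (N + 1) (Fin 3) T3 => trunc ℓ (J (a + q.1, q.2)) :=
    (htr ℓ).comp (hJ.comp ((measurable_const.add measurable_fst).prodMk measurable_snd))
  have hjm := measurable_jumpSum hσ hσ' N hJa 0 h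
  -- the time-integral part
  have hΛu := LambertianContactSwapLambertianEulerJointMeasurable.measurable_lambertFlow_uncurry_torus hσ.le hσ' N
  have hm : Measurable fun q : (Config (N + 1) (Fin 3) T3 × (ℕ → V3)) × ℝ =>
      ∑ i, GX (a + q.2, lambertFlow (Torus.geometry (Fin 3)) (hsDiameter σ N) q.1.2 q.1.1 q.2 i) :=
    Finset.measurable_sum _ fun i _ =>
      hGX.comp ((measurable_const.add measurable_snd).prodMk ((measurable_pi_apply i).comp hΛu))
  have hFsm : StronglyMeasurable fun q : Config (N + 1) (Fin 3) T3 × (ℕ → V3) =>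
      ∫ r in (0 : ℝ)..h, ∑ i, GX (a + r, lambertFlow (Torus.geometry (Fin 3)) (hsDiameter σ N) q.2 q.1 r i) := by
    simp only [intervalIntegral.integral_of_le hh]
    exact hm.stronglyMeasurable.integral_prod_right' (ν := volume.restrict (Ioc 0 h))
  exact (((htr L).comp hjm).sub hFsm.measurable).sub measurable_const

/-- **Uniform bound of the restarted clamped collisional functional**: `|·| ≤ L + h (N+1) B + |cZ|` for `L ≥ 0` and `|GX| ≤ B`.
[folklore] -/
theorem abs_restartedFunctional_le (N : ℕ) (J : ℝ × Config (N + 1) (Fin 3) T3 → ℝ) {GX : ℝ × (T3 × V3) → ℝ} {B : ℝ}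
    (hB : ∀ q, |GX q| ≤ B) (ℓ : ℝ) {L : ℝ} (hL : 0 ≤ L) (cZ a : ℝ) {h : ℝ} (hh : 0 ≤ h)
    (q : Config (N + 1) (Fin 3) T3 × (ℕ → V3)) :
    |trunc L (∑ m ∈ Finset.range (lambertCount (Torus.geometry (Fin 3)) (hsDiameter σ N) q.2 q.1 h),
          if 0 < (lambertInstant (Torus.geometry (Fin 3)) (hsDiameter σ N) q.2 q.1 (m + 1)).toReal then
            trunc ℓ (J (a + (lambertInstant (Torus.geometry (Fin 3)) (hsDiameter σ N) q.2 q.1 (m + 1)).toReal,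
              lambertStateAfter (Torus.geometry (Fin 3)) (hsDiameter σ N) q.2 q.1 m)) else 0) -
        (∫ r in (0 : ℝ)..h, ∑ i, GX (a + r, lambertFlow (Torus.geometry (Fin 3)) (hsDiameter σ N) q.2 q.1 r i)) - cZ| ≤
      L + h * (((N : ℝ) + 1) * B) + |cZ| := by
  have h1 := abs_trunc_le' hL (∑ m ∈ Finset.range (lambertCount (Torus.geometry (Fin 3)) (hsDiameter σ N) q.2 q.1 h),
          if 0 < (lambertInstant (Torus.geometry (Fin 3)) (hsDiameter σ N) q.2 q.1 (m + 1)).toReal then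
            trunc ℓ (J (a + (lambertInstant (Torus.geometry (Fin 3)) (hsDiameter σ N) q.2 q.1 (m + 1)).toReal,
              lambertStateAfter (Torus.geometry (Fin 3)) (hsDiameter σ N) q.2 q.1 m)) else 0)
  have hsum : ∀ (r : ℝ), ‖∑ i, GX (a + r, lambertFlow (Torus.geometry (Fin 3)) (hsDiameter σ N) q.2 q.1 r i)‖ ≤
      ((N : ℝ) + 1) * B := by
    intro r
    rw [Real.norm_eq_abs]
    calc |∑ i, GX (a + r, lambertFlow (Torus.geometry (Fin 3)) (hsDiameter σ N) q.2 q.1 r i)|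
        ≤ ∑ i, |GX (a + r, lambertFlow (Torus.geometry (Fin 3)) (hsDiameter σ N) q.2 q.1 r i)| := Finset.abs_sum_le_sum_abs _ _
      _ ≤ ∑ _i : Fin (N + 1), B := Finset.sum_le_sum fun i _ => hB _
      _ = ((N : ℝ) + 1) * B := by
          simp only [Finset.sum_const, Finset.card_univ, Fintype.card_fin, nsmul_eq_mul, Nat.cast_add, Nat.cast_one]
  have h2 : |∫ r in (0 : ℝ)..h, ∑ i, GX (a + r, lambertFlow (Torus.geometry (Fin 3)) (hsDiameter σ N) q.2 q.1 r i)| ≤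
      h * (((N : ℝ) + 1) * B) := by
    have h3 := intervalIntegral.norm_integral_le_of_norm_le_const (a := (0 : ℝ)) (b := h) (C := ((N : ℝ) + 1) * B)
      (f := fun r => ∑ i, GX (a + r, lambertFlow (Torus.geometry (Fin 3)) (hsDiameter σ N) q.2 q.1 r i))
      (fun r _ => hsum r)
    rw [Real.norm_eq_abs, sub_zero, abs_of_nonneg hh, mul_comm] at h3
    exact h3
  calc _ ≤ |trunc L (∑ m ∈ Finset.range (lambertCount (Torus.geometry (Fin 3)) (hsDiameter σ N) q.2 q.1 h),
          if 0 < (lambertInstant (Torus.geometry (Fin 3)) (hsDiameter σ N) q.2 q.1 (m + 1)).toReal then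
            trunc ℓ (J (a + (lambertInstant (Torus.geometry (Fin 3)) (hsDiameter σ N) q.2 q.1 (m + 1)).toReal,
              lambertStateAfter (Torus.geometry (Fin 3)) (hsDiameter σ N) q.2 q.1 m)) else 0) -
        (∫ r in (0 : ℝ)..h, ∑ i, GX (a + r, lambertFlow (Torus.geometry (Fin 3)) (hsDiameter σ N) q.2 q.1 r i))| + |cZ| :=
          abs_sub _ _
    _ ≤ (L + h * (((N : ℝ) + 1) * B)) + |cZ| := by
          gcongr
          exact (abs_sub _ _).trans (add_le_add h1 h2)

/-! ## §3 The entropy step with restart for the clamped collisional functional -/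

/-- **ENTROPY STEP PER WINDOW, COLLISIONAL.** For probability laws `P ≪ liouville` (data) and `R` (reference), a measurable jump
observable `J` invariant under the initial free flight, a bounded measurable one-body observable `GX`, levels `ℓ` and `L ≥ 0`, a constant
`cZ`, a window `(a, a+h]` (`a ≥ 0`, `h > 0`) and a rate `γ > 0`: if the entropy of the law of `Λ_a` w.r.t. `R` is finite and `≤ M`, and the
log-moment-generating function of `−(γ/h)·(restarted clamped collisional functional)` under `R ⊗ γ^ℕ` is `≤ Γ`, then
`−E_{P⊗γ^ℕ}[clamped collisional functional of (a, a+h]] ≤ (h/γ)(M + Γ)`. [cite: Yau1991, §2] -/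
theorem neg_clampedFunctional_le_of_ent : ∀ {σ : ℝ}, 0 < σ → σ < 2⁻¹ → ∀ (N : ℕ) (P R : Measure (Config (N + 1) (Fin 3) T3))
    [IsProbabilityMeasure P] [IsProbabilityMeasure R], P ≪ liouville (Torus.geometry (Fin 3)) (N + 1) (hsDiameter σ N) →
    ∀ {J : ℝ × Config (N + 1) (Fin 3) T3 → ℝ}, Measurable J →
    (∀ (t : ℝ) (w : Config (N + 1) (Fin 3) T3) (u : ℝ), 0 ≤ u →
      ENNReal.ofReal u < freeExitTime (Torus.geometry (Fin 3)) (hsDiameter σ N) w →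
      freeExitTime (Torus.geometry (Fin 3)) (hsDiameter σ N) w ≠ ⊤ →
      J (t, freeFlight (Torus.geometry (Fin 3)) u w) = J (t, w)) →
    ∀ {GX : ℝ × (T3 × V3) → ℝ}, Measurable GX → ∀ {B : ℝ}, (∀ q, |GX q| ≤ B) →
    ∀ (ℓ : ℝ) {L : ℝ}, 0 ≤ L → ∀ (cZ : ℝ) {a h γ M Γ : ℝ}, 0 ≤ a → 0 < h → 0 < γ →
    klDiv (((P.prod (lambertNoise (Fin 3))).map
        (fun p => lambertFlow (Torus.geometry (Fin 3)) (hsDiameter σ N) p.2 p.1 a))) R ≠ ⊤ →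
    (klDiv (((P.prod (lambertNoise (Fin 3))).map
        (fun p => lambertFlow (Torus.geometry (Fin 3)) (hsDiameter σ N) p.2 p.1 a))) R).toReal ≤ M →
    Real.log (∫ q, Real.exp (-(γ / h *
        (trunc L (∑ m ∈ Finset.range (lambertCount (Torus.geometry (Fin 3)) (hsDiameter σ N) q.2 q.1 h),
            if 0 < (lambertInstant (Torus.geometry (Fin 3)) (hsDiameter σ N) q.2 q.1 (m + 1)).toReal then
              trunc ℓ (J (a + (lambertInstant (Torus.geometry (Fin 3)) (hsDiameter σ N) q.2 q.1 (m + 1)).toReal,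
                lambertStateAfter (Torus.geometry (Fin 3)) (hsDiameter σ N) q.2 q.1 m)) else 0) -
          (∫ r in (0 : ℝ)..h, ∑ i, GX (a + r, lambertFlow (Torus.geometry (Fin 3)) (hsDiameter σ N) q.2 q.1 r i)) - cZ)))
        ∂(R.prod (lambertNoise (Fin 3)))) ≤ Γ →
    -(∫ p, (trunc L (∑ m ∈ Finset.range (lambertCount (Torus.geometry (Fin 3)) (hsDiameter σ N) p.2 p.1 (a + h)),
          if a < (lambertInstant (Torus.geometry (Fin 3)) (hsDiameter σ N) p.2 p.1 (m + 1)).toReal then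
            trunc ℓ (J ((lambertInstant (Torus.geometry (Fin 3)) (hsDiameter σ N) p.2 p.1 (m + 1)).toReal,
              lambertStateAfter (Torus.geometry (Fin 3)) (hsDiameter σ N) p.2 p.1 m)) else 0) -
        (∫ r in a..(a + h), ∑ i, GX (r, lambertFlow (Torus.geometry (Fin 3)) (hsDiameter σ N) p.2 p.1 r i)) - cZ)
        ∂(P.prod (lambertNoise (Fin 3)))) ≤ h / γ * (M + Γ) := by
  intro σ hσ hσ' N P R _ _ hP J hJ hJinv GX hGX B hB ℓ L hL cZ a h γ M Γ ha hh hγ hfin hM hΓ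
  have hβ : 0 < γ / h := div_pos hγ hh
  -- restart, almost surely
  rw [integral_congr_ae (clampedFunctional_ae_eq_restart hσ hσ' N P hP J hJinv GX ℓ L cZ ha hh.le)]
  have hHm := measurable_restartedFunctional hσ hσ' N hJ hGX ℓ L cZ a hh.le
  have hHb := abs_restartedFunctional_le (σ := σ) N J hB ℓ hL cZ a hh.le
  have h1 := restart_entropyInequality hσ hσ' N P R hP _ hHm _ hHb a (γ / h) ha hβ hfin
  rw [inv_div] at h1
  refine h1.trans ?_
  exact mul_le_mul_of_nonneg_left (add_le_add hM hΓ) (div_nonneg hh.le hγ.le)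

end Summit.AtomisticToContinuum.HydrodynamicLimit.Theorems.LambertianContactSwapLambertianEulerCollisionalWindowRestart
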